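import Summits.CriticalPhenomena.PercolationContinuityZ3.Theorems.PercNearOneGluingNoHeavyQuantFarGate3Band
import HarnessLib

/-!
# QUANT lane R8, front "FAR beyond trees", layer one — THE DEGREE-THREE GATE AT THE OBSERVER, XVIII: the band with at most one relay

builds on p205010 (kernel theorem, internal audit signed; external expert review pending)

Support file (`--supports stmt-CriticalPhenomena-4575`), seat `prim-quant-p1` (gen 28); memo
`run/shared/lean/prim/quant/prim-quant-p1-g28/FOR-LEAD-GATE3.md` §6c.  Standard axioms; no sorries; no definitions.

**The band with at most one relay.**  File XVII's band theorem needs `n ≥ 1` relays besides the gate (its type value `t₄ = 1 − nπ`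
is the `k = 2` entry); for `n ≤ 1` — in particular the bare gate `A = {v, u₁, u₂}` — the right value is the `k = 1` entry `t₄ = 1 − π`, with the
`k`-switch conditions `C1' : π(1−f₁) ≤ W₁`, `C2'`, `C3 : π ≤ 1`.  Same engine (`Gate3.arith_item`), same witness form.
-/

noncomputable section

namespace Summit.CriticalPhenomena.PercolationContinuityZ3.Theorems

namespace Quant

open Finset MeasureTheory Set
open Literature.Probability.LatticeModels
open Literature.Probability.Percolation
open Bundle (offZ)
open scoped Classical

namespace Gate3

/-- **The band certificate for at most one relay** (`n = |A ∖ {v,u₁,u₂}| ≤ 1`, in particular the bare gate `A = {v,u₁,u₂}`): as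
`Gate3.arith_band` with the type value `t₄ = 1 − π` (the `k = 1` entry) and the side conditions `C1', C2'` in place of `C0–C2`; witnesses exist
at `π ∈ {ρ₃, ρ₀, 0}` on 245 of the 279 non-tame grid points at `n = 0` (`num3/band6.py`; the rest is the Harris band). [this work] -/
theorem arith_band₀ (p r₁ r₂ nn π μ lv l1 l2 : ℝ) (hp1 : p ≤ 1) (hr10 : 0 ≤ r₁) (hr11 : r₁ ≤ 1) (hr20 : 0 ≤ r₂) (hr21 : r₂ ≤ 1)
    (hn0 : 0 ≤ nn) (hn1 : nn ≤ 1) (hμ0 : 0 ≤ μ) (hμπ : μ ≤ π) (hlv : 0 ≤ lv) (hl1 : 0 ≤ l1) (hl2 : 0 ≤ l2) (hsl : lv + l1 + l2 + nn * (π - μ) = 1)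
    (hρ0 : p * ((1 - r₁) * (1 - r₂)) ≤ π * (1 - p * max r₁ r₂))
    (hρ3 : π * (1 - p * (1 - (1 - r₁) * (1 - r₂))) ≤ p * ((1 - r₁) * (1 - r₂)))
    (hC1 : π * (1 - (1 - (1 - p) * (1 - r₁)) * r₂) ≤ (1 - p) * (1 - r₁))
    (hC2 : π * (1 - (1 - (1 - p) * (1 - r₂)) * r₁) ≤ (1 - p) * (1 - r₂))
    (hC3 : π ≤ 1)
    (hg0 : 0 ≤ (p - π * ((1 + p * max r₁ r₂ * (nn - 1)))) - lv * p - l1 * (p * r₁) - l2 * (p * r₂) + μ * (2 - (p + (p * r₁) + (p * r₂))))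
    (hg1 : 0 ≤ ((1 - (1 - p) * (1 - r₁)) - π * ((1 - (1 - p) * (1 - r₁)) * r₂ * nn)) - lv * (1 - (1 - p) * (1 - r₁)) - l1 * 1 - l2 * (r₂ * (1 - (1 - p) * (1 - r₁))) + μ * (2 - ((1 - (1 - p) * (1 - r₁)) + 1 + (r₂ * (1 - (1 - p) * (1 - r₁))))))
    (hg2 : 0 ≤ ((1 - (1 - p) * (1 - r₂)) - π * ((1 - (1 - p) * (1 - r₂)) * r₁ * nn)) - lv * (1 - (1 - p) * (1 - r₂)) - l1 * (r₁ * (1 - (1 - p) * (1 - r₂))) - l2 * 1 + μ * (2 - ((1 - (1 - p) * (1 - r₂)) + (r₁ * (1 - (1 - p) * (1 - r₂))) + 1)))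
    (hg3 : 0 ≤ (p * (1 - (1 - r₁) * (1 - r₂)) - π * (p * (1 - (1 - r₁) * (1 - r₂)) * nn)) - lv * p - l1 * (p * (1 - (1 - r₁) * (1 - r₂))) - l2 * (p * (1 - (1 - r₁) * (1 - r₂))) + μ * (2 - (p + (p * (1 - (1 - r₁) * (1 - r₂))) + (p * (1 - (1 - r₁) * (1 - r₂))))))
    (hg4 : 0 ≤ (1 - π * ((1 + 0 * (nn - 1)))) - lv * (1 - (1 - p) * ((1 - r₁) * (1 - r₂))) - l1 * 1 - l2 * 1 + μ * (2 - ((1 - (1 - p) * ((1 - r₁) * (1 - r₂))) + 1 + 1))) :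
    ∀ (t S a0 a1 a2 b10 b11 b12 b20 b21 b22 c0 c1 c2 d0 d1 d2 : ℝ), 0 ≤ a0 → 0 ≤ a1 → 0 ≤ a2 → 0 ≤ b10 → 0 ≤ b11 → 0 ≤ b12 → 0 ≤ b20 → 0 ≤ b21 → 0 ≤ b22 → 0 ≤ c0 → 0 ≤ c1 → 0 ≤ c2 → 0 ≤ d0 → 0 ≤ d1 → 0 ≤ d2 →
        a0 + a1 + a2 + b10 + b11 + b12 + b20 + b21 + b22 + c0 + c1 + c2 + d0 + d1 + d2 = 1 →
        ((a0 + a1 + a2) + (c0 + c1 + c2) + (b20 + b21 + b22)) * ((a0 + a1 + a2) + (b10 + b11 + b12)) ≤ (a0 + a1 + a2) →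
        ((a0 + a1 + a2) + (c0 + c1 + c2) + (b10 + b11 + b12)) * ((a0 + a1 + a2) + (b20 + b21 + b22)) ≤ (a0 + a1 + a2) →
        ((a0 + a1 + a2) + (b10 + b11 + b12) + (b20 + b21 + b22)) * ((a0 + a1 + a2) + (c0 + c1 + c2)) ≤ (a0 + a1 + a2) →
        (1 - p) * (r₁ * r₂) * ((a0 + a1 + a2) + (c0 + c1 + c2)) + (1 - p) * (r₁ * (1 - r₂)) * ((a0 + a1 + a2) + (c0 + c1 + c2) + (b20 + b21 + b22)) + (1 - p) * ((1 - r₁) * r₂) * ((a0 + a1 + a2) + (c0 + c1 + c2) + (b10 + b11 + b12)) + (1 - p) * ((1 - r₁) * (1 - r₂)) ≤ t →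
        p * ((1 - r₁) * r₂) * ((a0 + a1 + a2) + (b20 + b21 + b22)) + (1 - p) * (r₁ * r₂) * ((a0 + a1 + a2) + (c0 + c1 + c2)) + (p * ((1 - r₁) * (1 - r₂)) + (1 - p) * (r₁ * (1 - r₂)) + (1 - p) * ((1 - r₁) * r₂) + (1 - p) * ((1 - r₁) * (1 - r₂))) * ((a0 + a1 + a2) + (c0 + c1 + c2) + (b20 + b21 + b22)) ≤ t →
        p * ((1 - r₂) * r₁) * ((a0 + a1 + a2) + (b10 + b11 + b12)) + (1 - p) * (r₂ * r₁) * ((a0 + a1 + a2) + (c0 + c1 + c2)) + (p * ((1 - r₂) * (1 - r₁)) + (1 - p) * (r₂ * (1 - r₁)) + (1 - p) * ((1 - r₂) * r₁) + (1 - p) * ((1 - r₂) * (1 - r₁))) * ((a0 + a1 + a2) + (c0 + c1 + c2) + (b10 + b11 + b12)) ≤ t →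
        nn - S ≤ nn * t →
        S ≤ (p * max r₁ r₂ * nn * a0 + (1 + p * max r₁ r₂ * (nn - 1)) * a1 + nn * a2) + ((1 - (1 - p) * (1 - r₁)) * r₂ * nn * b10 + (1 + (1 - (1 - p) * (1 - r₁)) * r₂ * (nn - 1)) * b11 + nn * b12) + ((1 - (1 - p) * (1 - r₂)) * r₁ * nn * b20 + (1 + (1 - (1 - p) * (1 - r₂)) * r₁ * (nn - 1)) * b21 + nn * b22) + (p * (1 - (1 - r₁) * (1 - r₂)) * nn * c0 + (1 + p * (1 - (1 - r₁) * (1 - r₂)) * (nn - 1)) * c1 + nn * c2) + ((1 : ℝ) * d1 + nn * d2) →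
        2 < (1 - ((1 - p) * (r₁ * r₂) * ((a0 + a1 + a2) + (c0 + c1 + c2)) + (1 - p) * (r₁ * (1 - r₂)) * ((a0 + a1 + a2) + (c0 + c1 + c2) + (b20 + b21 + b22)) + (1 - p) * ((1 - r₁) * r₂) * ((a0 + a1 + a2) + (c0 + c1 + c2) + (b10 + b11 + b12)) + (1 - p) * ((1 - r₁) * (1 - r₂)))) + (1 - (p * ((1 - r₁) * r₂) * ((a0 + a1 + a2) + (b20 + b21 + b22)) + (1 - p) * (r₁ * r₂) * ((a0 + a1 + a2) + (c0 + c1 + c2)) + (p * ((1 - r₁) * (1 - r₂)) + (1 - p) * (r₁ * (1 - r₂)) + (1 - p) * ((1 - r₁) * r₂) + (1 - p) * ((1 - r₁) * (1 - r₂))) * ((a0 + a1 + a2) + (c0 + c1 + c2) + (b20 + b21 + b22)))) + (1 - (p * ((1 - r₂) * r₁) * ((a0 + a1 + a2) + (b10 + b11 + b12)) + (1 - p) * (r₂ * r₁) * ((a0 + a1 + a2) + (c0 + c1 + c2)) + (p * ((1 - r₂) * (1 - r₁)) + (1 - p) * (r₂ * (1 - r₁)) + (1 - p) * ((1 - r₂)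 * r₁) + (1 - p) * ((1 - r₂) * (1 - r₁))) * ((a0 + a1 + a2) + (c0 + c1 + c2) + (b10 + b11 + b12)))) + S →
        p * ((1 - r₁) * (1 - r₂)) * (a0 + c0) + (1 - p) * (r₁ * r₂) * (a0 + a1 + c0 + c1) + (1 - p) * (r₁ * (1 - r₂)) * (a0 + a1 + c0 + c1 + b20) + (1 - p) * ((1 - r₁) * r₂) * (a0 + a1 + c0 + c1 + b10) + (1 - p) * ((1 - r₁) * (1 - r₂)) * (a0 + a1 + c0 + c1 + b10 + b20) ≤ t := by
  intro t S a0 a1 a2 b10 b11 b12 b20 b21 b22 c0 c1 c2 d0 d1 d2 hna0 hna1 hna2 hnb10 hnb11 hnb12 hnb20 hnb21 hnb22 hnc0 hnc1 hnc2 hnd0 hnd1 hnd2 hsum hH1 hH2 hH3 hcv hc1 hc2 hout hsub hmean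
  have hπ0 : 0 ≤ π := le_trans hμ0 hμπ
  have hW12 : 0 ≤ (1 - r₁) * (1 - r₂) := mul_nonneg (sub_nonneg.2 hr11) (sub_nonneg.2 hr21)
  have hW12le : (1 - r₁) * (1 - r₂) ≤ 1 := by
    have h := mul_le_mul (sub_le_self 1 hr10) (sub_le_self 1 hr20) (sub_nonneg.2 hr21) zero_le_one
    linarith only [h]
  have hW1le : 1 - (1 - p) * (1 - r₁) ≤ 1 := by
    have h := mul_nonneg (sub_nonneg.2 hp1) (sub_nonneg.2 hr11)
    linarith only [h]
  have hW2le : 1 - (1 - p) * (1 - r₂) ≤ 1 := by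
    have h := mul_nonneg (sub_nonneg.2 hp1) (sub_nonneg.2 hr21)
    linarith only [h]
  have hf1le : (1 - (1 - p) * (1 - r₁)) * r₂ ≤ 1 := by
    have h := mul_le_mul hW1le hr21 hr20 zero_le_one
    linarith only [h]
  have hf2le : (1 - (1 - p) * (1 - r₂)) * r₁ ≤ 1 := by
    have h := mul_le_mul hW2le hr11 hr10 zero_le_one
    linarith only [h]
  have hf3le : p * (1 - (1 - r₁) * (1 - r₂)) ≤ 1 := by
    have h := mul_le_mul hp1 (sub_le_self 1 hW12) (by linarith only [hW12le]) zero_le_one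
    linarith only [h]
  have hm0 : 0 ≤ max r₁ r₂ := le_trans hr10 (le_max_left _ _)
  have hm1 : max r₁ r₂ ≤ 1 := max_le hr11 hr21
  have hD0 : 0 ≤ 1 - p * max r₁ r₂ := by
    have h := mul_le_mul hp1 hm1 hm0 zero_le_one
    linarith only [h]
  have hC3x : π * (1 - p * max r₁ r₂) ≤ 1 - p * max r₁ r₂ := by
    have h := mul_le_mul_of_nonneg_right hC3 hD0
    linarith only [h]
  have ca0 : p - π * ((1 + p * max r₁ r₂ * (nn - 1))) ≤ p * (1 - (1 - r₁) * (1 - r₂)) - π * (p * max r₁ r₂ * nn) := by linarith only [hρ0]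
  have ca1 : p - π * ((1 + p * max r₁ r₂ * (nn - 1))) ≤ p - π * ((1 + p * max r₁ r₂ * (nn - 1))) := le_refl _
  have ca2 : p - π * ((1 + p * max r₁ r₂ * (nn - 1))) ≤ 1 - π * (nn) := by
    have h := mul_nonneg (mul_nonneg hπ0 (sub_nonneg.2 hn1)) hD0
    linarith only [h, hp1, hC3x]
  have cb10 : (1 - (1 - p) * (1 - r₁)) - π * ((1 - (1 - p) * (1 - r₁)) * r₂ * nn) ≤ (1 - (1 - p) * (1 - r₁)) - π * ((1 - (1 - p) * (1 - r₁)) * r₂ * nn) := le_refl _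
  have cb11 : (1 - (1 - p) * (1 - r₁)) - π * ((1 - (1 - p) * (1 - r₁)) * r₂ * nn) ≤ 1 - π * ((1 + (1 - (1 - p) * (1 - r₁)) * r₂ * (nn - 1))) := by linarith only [hC1]
  have cb12 : (1 - (1 - p) * (1 - r₁)) - π * ((1 - (1 - p) * (1 - r₁)) * r₂ * nn) ≤ 1 - π * (nn) := by
    have h := mul_le_mul_of_nonneg_left hn1 (mul_nonneg hπ0 (sub_nonneg.2 hf1le))
    linarith only [h, hC1]
  have cb20 : (1 - (1 - p) * (1 - r₂)) - π * ((1 - (1 - p) * (1 - r₂)) * r₁ * nn) ≤ (1 - (1 - p) * (1 - r₂)) - π * ((1 - (1 - p) * (1 - r₂)) * r₁ * nn) := le_refl _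
  have cb21 : (1 - (1 - p) * (1 - r₂)) - π * ((1 - (1 - p) * (1 - r₂)) * r₁ * nn) ≤ 1 - π * ((1 + (1 - (1 - p) * (1 - r₂)) * r₁ * (nn - 1))) := by linarith only [hC2]
  have cb22 : (1 - (1 - p) * (1 - r₂)) - π * ((1 - (1 - p) * (1 - r₂)) * r₁ * nn) ≤ 1 - π * (nn) := by
    have h := mul_le_mul_of_nonneg_left hn1 (mul_nonneg hπ0 (sub_nonneg.2 hf2le))
    linarith only [h, hC2]
  have cc0 : p * (1 - (1 - r₁) * (1 - r₂)) - π * (p * (1 - (1 - r₁) * (1 - r₂)) * nn) ≤ p * (1 - (1 - r₁) * (1 - r₂)) - π * (p * (1 - (1 - r₁) * (1 - r₂)) * nn) := le_refl _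
  have cc1 : p * (1 - (1 - r₁) * (1 - r₂)) - π * (p * (1 - (1 - r₁) * (1 - r₂)) * nn) ≤ p - π * ((1 + p * (1 - (1 - r₁) * (1 - r₂)) * (nn - 1))) := by linarith only [hρ3]
  have cc2 : p * (1 - (1 - r₁) * (1 - r₂)) - π * (p * (1 - (1 - r₁) * (1 - r₂)) * nn) ≤ 1 - π * (nn) := by
    have h1 := mul_le_mul_of_nonneg_left hn1 hπ0
    have h := mul_nonneg (sub_nonneg.2 hf3le) (sub_nonneg.2 hC3)
    have h' := mul_nonneg (sub_nonneg.2 hf3le) (sub_nonneg.2 h1)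
    linarith only [h, h', h1, hC3]
  have cd0 : 1 - π * ((1 + 0 * (nn - 1))) ≤ 1 - π * (0 * nn) := by
    have hx : 0 ≤ π * nn := mul_nonneg hπ0 hn0
    linarith only [hx, hπ0]
  have cd1 : 1 - π * ((1 + 0 * (nn - 1))) ≤ 1 - π * ((1 + 0 * (nn - 1))) := le_refl _
  have cd2 : 1 - π * ((1 + 0 * (nn - 1))) ≤ 1 - π * (nn) := by
    have h1 := mul_le_mul_of_nonneg_left hn1 hπ0
    linarith only [h1]
  exact arith_item p r₁ r₂ nn π μ lv l1 l2 _ _ _ _ _ hμ0 hμπ hlv hl1 hl2 hsl ca0 ca1 ca2 cb10 cb11 cb12 cb20 cb21 cb22 cc0 cc1 cc2 cd0 cd1 cd2 hg0 hg1 hg2 hg3 hg4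
    t S a0 a1 a2 b10 b11 b12 b20 b21 b22 c0 c1 c2 d0 d1 d2 hna0 hna1 hna2 hnb10 hnb11 hnb12 hnb20 hnb21 hnb22 hnc0 hnc1 hnc2 hnd0 hnd1 hnd2 hsum hH1 hH2 hH3 hcv hc1 hc2 hout hsub hmean

end Gate3

variable {n : ℕ}

/-- **FAR at layer one for the degree-three gate with at most one further relay** (`|A ∖ {v,u₁,u₂}| ≤ 1`, incl. the bare gate),
witness form as in `farLayerOne_of_gate3_band`. [this work] -/
theorem farLayerOne_of_gate3_band₀ (w : Sym2 (Fin n) → unitInterval) (A : Finset (Fin n)) {o v u₁ u₂ : Fin n}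
    (hov : o ≠ v) (h1v : u₁ ≠ v) (h2v : u₂ ≠ v) (ho1 : o ≠ u₁) (ho2 : o ≠ u₂) (h12 : u₁ ≠ u₂)
    (hvA : v ∈ A) (h1A : u₁ ∈ A) (h2A : u₂ ∈ A)
    (hw : ∀ z : Fin n, z ≠ o → z ≠ u₁ → z ≠ u₂ → z ≠ v → (w s(v, z) : ℝ) = 0)
    (hn1 : ((((A.erase v).erase u₁).erase u₂).card : ℝ) ≤ 1) (π μ lv l1 l2 : ℝ) (hμ0 : 0 ≤ μ) (hμπ : μ ≤ π) (hlv : 0 ≤ lv) (hl1 : 0 ≤ l1) (hl2 : 0 ≤ l2)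
    (hsl : lv + l1 + l2 + ((((A.erase v).erase u₁).erase u₂).card : ℝ) * (π - μ) = 1)
    (hρ0 : (w s(o, v) : ℝ) * ((1 - (w s(v, u₁) : ℝ)) * (1 - (w s(v, u₂) : ℝ))) ≤ π * (1 - (w s(o, v) : ℝ) * max (w s(v, u₁) : ℝ) (w s(v, u₂) : ℝ)))
    (hρ3 : π * (1 - (w s(o, v) : ℝ) * (1 - (1 - (w s(v, u₁) : ℝ)) * (1 - (w s(v, u₂) : ℝ)))) ≤ (w s(o, v) : ℝ) * ((1 - (w s(v, u₁) : ℝ)) * (1 - (w s(v, u₂) : ℝ))))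
    (hC1 : π * (1 - (1 - (1 - (w s(o, v) : ℝ)) * (1 - (w s(v, u₁) : ℝ))) * (w s(v, u₂) : ℝ)) ≤ (1 - (w s(o, v) : ℝ)) * (1 - (w s(v, u₁) : ℝ)))
    (hC2 : π * (1 - (1 - (1 - (w s(o, v) : ℝ)) * (1 - (w s(v, u₂) : ℝ))) * (w s(v, u₁) : ℝ)) ≤ (1 - (w s(o, v) : ℝ)) * (1 - (w s(v, u₂) : ℝ)))
    (hC3 : π ≤ 1)
    (hg0 : 0 ≤ ((w s(o, v) : ℝ) - π * ((1 + (w s(o, v) : ℝ) * max (w s(v, u₁) : ℝ) (w s(v, u₂) : ℝ) * (((((A.erase v).erase u₁).erase u₂).card : ℝ) - 1)))) - lv * (w s(o, v) : ℝ) - l1 * ((w s(o, v) : ℝ) * (w s(v, u₁) : ℝ)) - l2 * ((w s(o, v) : ℝ) * (w s(v, u₂) : ℝ)) + μ * (2 - ((w s(o, v) : ℝ) + ((w s(o, v) : ℝ) * (w s(v, u₁) : ℝ)) + ((w s(o, v) : ℝ) * (w s(v, u₂) : ℝ)))))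
    (hg1 : 0 ≤ ((1 - (1 - (w s(o, v) : ℝ)) * (1 - (w s(v, u₁) : ℝ))) - π * ((1 - (1 - (w s(o, v) : ℝ)) * (1 - (w s(v, u₁) : ℝ))) * (w s(v, u₂) : ℝ) * ((((A.erase v).erase u₁).erase u₂).card : ℝ))) - lv * (1 - (1 - (w s(o, v) : ℝ)) * (1 - (w s(v, u₁) : ℝ))) - l1 * 1 - l2 * ((w s(v, u₂) : ℝ) * (1 - (1 - (w s(o, v) : ℝ)) * (1 - (w s(v, u₁) : ℝ)))) + μ * (2 - ((1 - (1 - (w s(o, v) : ℝ)) * (1 - (w s(v, u₁) : ℝ))) + 1 + ((w s(v, u₂) : ℝ) * (1 - (1 - (w s(o, v) : ℝ)) * (1 - (w s(v, u₁) : ℝ)))))))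
    (hg2 : 0 ≤ ((1 - (1 - (w s(o, v) : ℝ)) * (1 - (w s(v, u₂) : ℝ))) - π * ((1 - (1 - (w s(o, v) : ℝ)) * (1 - (w s(v, u₂) : ℝ))) * (w s(v, u₁) : ℝ) * ((((A.erase v).erase u₁).erase u₂).card : ℝ))) - lv * (1 - (1 - (w s(o, v) : ℝ)) * (1 - (w s(v, u₂) : ℝ))) - l1 * ((w s(v, u₁) : ℝ) * (1 - (1 - (w s(o, v) : ℝ)) * (1 - (w s(v, u₂) : ℝ)))) - l2 * 1 + μ * (2 - ((1 - (1 - (w s(o, v) : ℝ)) * (1 - (w s(v, u₂) : ℝ))) + ((w s(v, u₁) : ℝ) * (1 - (1 - (w s(o, v) : ℝ)) * (1 - (w s(v, u₂) : ℝ)))) + 1)))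
    (hg3 : 0 ≤ ((w s(o, v) : ℝ) * (1 - (1 - (w s(v, u₁) : ℝ)) * (1 - (w s(v, u₂) : ℝ))) - π * ((w s(o, v) : ℝ) * (1 - (1 - (w s(v, u₁) : ℝ)) * (1 - (w s(v, u₂) : ℝ))) * ((((A.erase v).erase u₁).erase u₂).card : ℝ))) - lv * (w s(o, v) : ℝ) - l1 * ((w s(o, v) : ℝ) * (1 - (1 - (w s(v, u₁) : ℝ)) * (1 - (w s(v, u₂) : ℝ)))) - l2 * ((w s(o, v) : ℝ) * (1 - (1 - (w s(v, u₁) : ℝ)) * (1 - (w s(v, u₂) : ℝ)))) + μ * (2 - ((w s(o, v) : ℝ) + ((w s(o, v) : ℝ) * (1 - (1 - (w s(v, u₁) : ℝ)) * (1 - (w s(v, u₂) : ℝ)))) + ((w s(o, v) : ℝ) * (1 - (1 - (w s(v, u₁) : ℝ)) * (1 - (w s(v, u₂) : ℝ)))))))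
    (hg4 : 0 ≤ (1 - π * ((1 + 0 * (((((A.erase v).erase u₁).erase u₂).card : ℝ) - 1)))) - lv * (1 - (1 - (w s(o, v) : ℝ)) * ((1 - (w s(v, u₁) : ℝ)) * (1 - (w s(v, u₂) : ℝ)))) - l1 * 1 - l2 * 1 + μ * (2 - ((1 - (1 - (w s(o, v) : ℝ)) * ((1 - (w s(v, u₁) : ℝ)) * (1 - (w s(v, u₂) : ℝ)))) + 1 + 1)))
    (t : ℝ) (hEN : 2 < ∑ a ∈ A, (prodBernoulli w).real (openConn o a))
    (hcut : ∀ a ∈ A, (prodBernoulli w).real (openConn o a : Set (BondConfig (Fin n)))ᶜ ≤ t) :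
    (prodBernoulli w).real {ω : BondConfig (Fin n) | (A.filter fun a => ω ∈ openConn o a).card ≤ 1} ≤ t :=
  farLayerOne_of_gate3_of_cover w A hov h1v h2v ho1 ho2 h12 hvA h1A h2A hw
    (Gate3.arith_band₀ (w s(o, v) : ℝ) (w s(v, u₁) : ℝ) (w s(v, u₂) : ℝ) ((((A.erase v).erase u₁).erase u₂).card : ℝ) π μ lv l1 l2 (w s(o, v)).2.2 (w s(v, u₁)).2.1 (w s(v, u₁)).2.2
      (w s(v, u₂)).2.1 (w s(v, u₂)).2.2 (Nat.cast_nonneg _) hn1 hμ0 hμπ hlv hl1 hl2 hsl hρ0 hρ3 hC1 hC2 hC3 hg0 hg1 hg2 hg3 hg4) t hEN hcut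

end Quant

end Summit.CriticalPhenomena.PercolationContinuityZ3.Theorems
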